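import Summits.FinalStateConjecture.FinalStateConjecture.Theorems.BartnikGapSettlingGapExhaustionPhotonShellNodeDefs
import Summits.FinalStateConjecture.FinalStateConjecture.Theorems.BartnikGapSettlingGapExhaustionDocLocalisation
import Summits.FinalStateConjecture.FinalStateConjecture.Theorems.BartnikGapSettlingGapExhaustionDocLocalisationUniform
import Summits.FinalStateConjecture.FinalStateConjecture.Theorems.BartnikGapSettlingGapExhaustionKerrBilinCoerciveExterior
import Summits.FinalStateConjecture.FinalStateConjecture.Theorems.BartnikGapSettlingGapExhaustionKerrBilinCoerciveUniform
import Summits.FinalStateConjecture.FinalStateConjecture.Theorems.BartnikGapSettlingGapExhaustionStarChartExtension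
import Summits.FinalStateConjecture.FinalStateConjecture.Theorems.BartnikGapSettlingGapExhaustionInjectiveMfderivOfClose
import HarnessLib

/-!
# Crux `GapExhaustion` (stmt-FinalStateConjecture-10808), line `photon-shell-pseudoconvexity`:
# the CHART PACKAGE and the D.O.C. LOCALISATION of an eternal near-Kerr star chart, over the
# landed node vocabulary `Theorems.PhotonShellNode` (rev c13 consolidation)

Route `BartnikGapSettling`; helper (`--supports stmt-FinalStateConjecture-10808`) of line lead
c13. The node-level consequences of §1f (escape / d.o.c. localisation) and the chart package of
§3b of the crux skeleton `Cruxes/GapExhaustion/Lines/photon_shell_pseudoconvexity.lean` (revs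
c9–c11, kernel-checked there as workfile content), moved VERBATIM over the landed vocabulary file
`…PhotonShellNodeDefs.lean` (p156510) so that the node's sweep theorems (S3/S5/S6b‴ modulo
Ionescu–Klainerman) can themselves be landed as `Theorems/` modules:
`farSilent_band_subset_docOf_of` / `…docOf` / `…belowZone` (per label) and `…docOfU` /
`…belowZoneU` (uniform over a compact label set) — under `FarSilentNearKerr` at order `≥ 1` and a
small tolerance the band `{r₊ + η ≤ r ≤ R}` of the star chart lies in `docOf = I⁻(far zone)`, so
`Ψ({r₊ + η ≤ r < ρ}) ⊆ belowZone ρ`; `farSilent_chartPackage_of` / `…` / `…U` — the star chart as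
a total map, smooth, openly embedded, injective with injective differential on `{r > M}`, with
the pointwise weighted bounds `‖Dʲ(Φ^*g − g_{M,a})(z)‖ ≤ δ' M / r^{j+1}`; and `rPlus_lt_rPhMinus`.
Bricks used: `Theorems.stub_docLocalisation[U]` (p131164 / UD), `stub_kerrBilin_coercive_exterior[U]`
(UC), `stub_starChartExtension`, `stub_injective_mfderiv_of_close`.
[cite: IonescuKlainerman2013] [cite: DafermosRodnianski2008, §5.1]
-/

noncomputable section

set_option maxSynthPendingDepth 3

-- D-0017: single-problem summit, `Summit.<S>.<S>.…` by design (cf. lakefile `weak.linter.dupNamespace`).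
set_option linter.dupNamespace false

namespace Summit.FinalStateConjecture.FinalStateConjecture.Theorems.PhotonShellNode

open Literature.Geometry.Lorentzian
open Set Filter
open scoped Manifold ContDiff Topology ENNReal

/-- **NODE CONSEQUENCE of §1f (rev c9): under `FarSilentNearKerr` at order `k ≥ 1` and a
tolerance `δ' ≤ δ₀(M, a, η, R)`, the band `{r₊ + η ≤ r ≤ R}` of the eternal star chart lies in
`docOf` — the domain of outer communications seen by the chart — for EVERY time orientation of
`𝓢`.** The star chart is read as a total map (`Theorems.stub_starChartExtension`), its differential
is injective on the whole star domain because the pulled-back form is within `δ'M/r ≤ δ'` of the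
uniformly coercive Kerr–Schild form (`Theorems.stub_kerrBilin_coercive_exterior`,
`Theorems.stub_injective_mfderiv_of_close`), the weighted bounds at orders `0, 1` give the
pointwise `C⁰/C¹` closeness `docLocalisation` consumes (`δ'M/r ≤ δ'`, `δ'M/r² ≤ δ'/M`), and the far
zone `{r > R}`, `R ≥ 3M`, lies in `farZone (3M)`. Hence `belowZone ρ ⊇ Ψ({r₊ + η ≤ r < ρ})` for
`ρ ≤ R`: the causal sets of S5/S6b ARE chart sublevel bands away from the horizon. -/
theorem farSilent_band_subset_docOf_of {M a η R δ β : ℝ} (hM : 0 < M) (hη : 0 < η)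
    (h3R : 3 * M ≤ R) (hδ : 0 < δ) (hβ : 0 < β)
    (hcoer : ∀ z : E4, M ≤ Kerr.radius a z → ∀ v : E4, β * ‖v‖ ≤ ‖Kerr.bilin M a z v‖)
    (hloc : ∀ (𝓢 : Spacetime.{0} 4) (Φ : E4 → 𝓢.carrier),
      ContMDiffOn 𝓘(ℝ, E4) (𝓡 4) ∞ Φ {z | M < Kerr.radius a z} →
      (∀ z : E4, M < Kerr.radius a z → Function.Injective (mfderiv 𝓘(ℝ, E4) (𝓡 4) Φ z)) →
      (∀ z : E4, Kerr.rPlus M a + η / 2 ≤ Kerr.radius a z → Kerr.radius a z ≤ R + 2 →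
        ‖𝓢.metricInCoords Φ z - Kerr.bilin M a z‖ ≤ δ ∧
        ‖fderiv ℝ (𝓢.metricInCoords Φ) z - fderiv ℝ (Kerr.bilin M a) z‖ ≤ δ) →
      ∀ z : E4, Kerr.rPlus M a + η ≤ Kerr.radius a z → Kerr.radius a z ≤ R →
        Φ z ∈ 𝓢.metric.chronologicalPast 𝓢.timeOrientation (Φ '' {y | R < Kerr.radius a y})) :
    ∀ (𝓢 : Spacetime.{0} 4) [𝓢.metric.HasLeviCivita] (Ψ : (starBG M a).domain → 𝓢.carrier)
      (k : ℕ) (δ' : ℝ), 1 ≤ k → δ' ≤ min (β / 2) (δ * min 1 M) → FarSilentNearKerr 𝓢 M a Ψ k δ' →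
      ∀ x : (starBG M a).domain, Kerr.rPlus M a + η ≤ Kerr.radius a x.1 →
        Kerr.radius a x.1 ≤ R → Ψ x ∈ docOf 𝓢 M a Ψ := by
  set δ₀ : ℝ := min (β / 2) (δ * min 1 M) with hδ₀def
  have hδ₀ : 0 < δ₀ := lt_min (by positivity) (by positivity)
  have hδ₀β : δ₀ < β := (min_le_left _ _).trans_lt (by linarith)
  have hδ₀δ : δ₀ ≤ δ := (min_le_right _ _).trans
    ((mul_le_mul_of_nonneg_left (min_le_left _ _) hδ.le).trans (mul_one δ).le)
  have hδ₀δM : δ₀ ≤ δ * M := (min_le_right _ _).trans (mul_le_mul_of_nonneg_left (min_le_right _ _) hδ.le)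
  intro 𝓢 _ Ψ k δ' hk hδ' hFS x hxlo hxR
  obtain ⟨-, hΨs, hΨe, hbound⟩ := hFS
  obtain ⟨Φ, hΦΨ, hdom, hΦs, -, -, hiter⟩ :=
    Theorems.stub_starChartExtension 𝓢 M a Ψ hM hΨs hΨe
  have hrpM : M ≤ Kerr.rPlus M a := le_add_of_nonneg_right (Real.sqrt_nonneg _)
  -- membership in the domain from `M < r`
  have hmem : ∀ z : E4, M < Kerr.radius a z → z ∈ ((starBG M a).domain : Set E4) := by
    intro z hz; rw [← hdom]; exact hz
  -- pointwise closeness of orders 0 and 1 from the weighted bounds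
  have hC0 : ∀ z : E4, M < Kerr.radius a z →
      ‖𝓢.metricInCoords Φ z - Kerr.bilin M a z‖ ≤ δ' * M / Kerr.radius a z := by
    intro z hz
    have hb := hbound ⟨z, hmem z hz⟩ 0 (Nat.zero_le _)
    have hit := hiter 0 ⟨z, hmem z hz⟩
    simp only [zero_add, pow_one] at hb
    rw [le_div_iff₀ (hM.trans hz), mul_comm]
    have : ‖iteratedFDeriv ℝ 0 (fun z ↦ 𝓢.metricInCoords Φ z - Kerr.bilin M a z) z‖ =
        ‖𝓢.metricInCoords Φ z - Kerr.bilin M a z‖ := norm_iteratedFDeriv_zero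
    rw [← this]
    simpa [hit] using hb
  have hO : IsOpen {z : E4 | M < Kerr.radius a z} := isOpen_lt continuous_const (Kerr.continuous_radius a)
  have hGs : ContDiffOn ℝ ∞ (𝓢.metricInCoords Φ) {z : E4 | M < Kerr.radius a z} :=
    𝓢.contDiffOn_metricInCoords hO hΦs
  have hC1 : ∀ z : E4, M < Kerr.radius a z →
      ‖fderiv ℝ (𝓢.metricInCoords Φ) z - fderiv ℝ (Kerr.bilin M a) z‖ ≤
        δ' * M / Kerr.radius a z ^ 2 := by
    intro z hz
    have hr : 0 < Kerr.radius a z := hM.trans hz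
    have hb := hbound ⟨z, hmem z hz⟩ 1 hk
    have hit := hiter 1 ⟨z, hmem z hz⟩
    have hGd : DifferentiableAt ℝ (𝓢.metricInCoords Φ) z :=
      ((hGs z hz).contDiffAt (hO.mem_nhds hz)).differentiableAt (by simp)
    have hKd : DifferentiableAt ℝ (Kerr.bilin M a) z :=
      (Kerr.contDiffAt_bilin M a hr (n := 1)).differentiableAt one_ne_zero
    have h1 : ‖iteratedFDeriv ℝ 1 (fun z ↦ 𝓢.metricInCoords Φ z - Kerr.bilin M a z) z‖ =
        ‖fderiv ℝ (𝓢.metricInCoords Φ) z - fderiv ℝ (Kerr.bilin M a) z‖ := by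
      rw [norm_iteratedFDeriv_one, fderiv_fun_sub hGd hKd]
    rw [le_div_iff₀ (by positivity), mul_comm, ← h1]
    simpa [hit] using hb
  -- injectivity of the differential on the whole star domain
  have hinj : ∀ z : E4, M < Kerr.radius a z → Function.Injective (mfderiv 𝓘(ℝ, E4) (𝓡 4) Φ z) := by
    intro z hz
    have hr : 0 < Kerr.radius a z := hM.trans hz
    refine Theorems.stub_injective_mfderiv_of_close.1 𝓢 Φ z (Kerr.bilin M a z) β hβ
      (hcoer z hz.le) ?_
    calc ‖𝓢.metricInCoords Φ z - Kerr.bilin M a z‖ ≤ δ' * M / Kerr.radius a z := hC0 z hz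
      _ ≤ δ₀ := by
          rw [div_le_iff₀ hr]
          have h1 : δ' * M ≤ δ₀ * M := mul_le_mul_of_nonneg_right hδ' hM.le
          have h2 : δ₀ * M ≤ δ₀ * Kerr.radius a z := mul_le_mul_of_nonneg_left hz.le hδ₀.le
          linarith
      _ < β := hδ₀β
  -- the closeness hypothesis of `docLocalisation` on the band `[r₊ + η/2, R + 2]`
  have hclose : ∀ z : E4, Kerr.rPlus M a + η / 2 ≤ Kerr.radius a z → Kerr.radius a z ≤ R + 2 →
      ‖𝓢.metricInCoords Φ z - Kerr.bilin M a z‖ ≤ δ ∧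
      ‖fderiv ℝ (𝓢.metricInCoords Φ) z - fderiv ℝ (Kerr.bilin M a) z‖ ≤ δ := by
    intro z hz _
    have hz' : M < Kerr.radius a z := by linarith
    have hr : 0 < Kerr.radius a z := hM.trans hz'
    have hδ'δ : δ' ≤ δ := hδ'.trans hδ₀δ
    refine ⟨(hC0 z hz').trans ?_, (hC1 z hz').trans ?_⟩
    · rw [div_le_iff₀ hr]
      have h1 : δ' * M ≤ δ * M := mul_le_mul_of_nonneg_right hδ'δ hM.le
      have h2 : δ * M ≤ δ * Kerr.radius a z := mul_le_mul_of_nonneg_left hz'.le hδ.le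
      linarith
    · rw [div_le_iff₀ (by positivity)]
      have h1 : δ' * M ≤ δ * M * M := by
        have := mul_le_mul_of_nonneg_right (hδ'.trans hδ₀δM) hM.le
        linarith
      have h2 : δ * M * M ≤ δ * Kerr.radius a z ^ 2 := by
        have hMr : M * M ≤ Kerr.radius a z ^ 2 := by nlinarith
        have := mul_le_mul_of_nonneg_left hMr hδ.le
        linarith
      linarith
  have hmain := hloc 𝓢 Φ hΦs hinj hclose x.1 hxlo hxR
  rw [hΦΨ x] at hmain
  -- the far zone `{r > R}`, `R ≥ 3M`, lies in `farZone (3M)`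
  refine LorentzianMetric.chronologicalPast_mono ?_ hmain
  rintro _ ⟨y, hy, rfl⟩
  have hyR : R < Kerr.radius a y := hy
  have hyM : M < Kerr.radius a y := by linarith
  refine ⟨⟨y, hmem y hyM⟩, ?_, (hΦΨ ⟨y, hmem y hyM⟩).symm⟩
  show 3 * M < Kerr.radius a y
  linarith

/-- **rev c9 — under `FarSilentNearKerr` with `k ≥ 1` and `δ'` small, the band
`{r₊ + η ≤ r ≤ R}` of the star chart lies in `docOf`** (per label; from the generic form
`farSilent_band_subset_docOf_of` with the constants of `Theorems.stub_docLocalisation` and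
`Theorems.stub_kerrBilin_coercive_exterior`). [folklore] -/
theorem farSilent_band_subset_docOf :
    ∀ (M a η R : ℝ), 0 < M → |a| < M → 0 < η → Kerr.rPlus M a + η ≤ R → 3 * M ≤ R →
      ∃ δ₀ : ℝ, 0 < δ₀ ∧
      ∀ (𝓢 : Spacetime.{0} 4) [𝓢.metric.HasLeviCivita] (Ψ : (starBG M a).domain → 𝓢.carrier)
        (k : ℕ) (δ' : ℝ), 1 ≤ k → δ' ≤ δ₀ → FarSilentNearKerr 𝓢 M a Ψ k δ' →
        ∀ x : (starBG M a).domain, Kerr.rPlus M a + η ≤ Kerr.radius a x.1 →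
          Kerr.radius a x.1 ≤ R → Ψ x ∈ docOf 𝓢 M a Ψ := by
  intro M a η R hM ha hη hR h3R
  obtain ⟨δ, hδ, hloc⟩ := Theorems.stub_docLocalisation M a η R hM ha hη hR
  obtain ⟨β, hβ, hcoer⟩ := Theorems.stub_kerrBilin_coercive_exterior M a M hM.le hM
  exact ⟨min (β / 2) (δ * min 1 M), lt_min (by positivity) (by positivity),
    farSilent_band_subset_docOf_of hM hη h3R hδ hβ hcoer hloc⟩

/-- **The causal sets of S5/S6b are chart sublevel bands away from the horizon (rev c9).** Under
the hypotheses of `farSilent_band_subset_docOf`, for every `ρ ≤ R`: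
`Ψ({r₊ + η ≤ r < ρ}) ⊆ belowZone ρ` (`= Ψ({r < ρ}) ∩ docOf`). [folklore corollary] -/
theorem farSilent_band_subset_belowZone :
    ∀ (M a η R : ℝ), 0 < M → |a| < M → 0 < η → Kerr.rPlus M a + η ≤ R → 3 * M ≤ R →
      ∃ δ₀ : ℝ, 0 < δ₀ ∧
      ∀ (𝓢 : Spacetime.{0} 4) [𝓢.metric.HasLeviCivita] (Ψ : (starBG M a).domain → 𝓢.carrier)
        (k : ℕ) (δ' : ℝ), 1 ≤ k → δ' ≤ δ₀ → FarSilentNearKerr 𝓢 M a Ψ k δ' →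
        ∀ ρ : ℝ, ρ ≤ R →
          Ψ '' {x | Kerr.rPlus M a + η ≤ Kerr.radius a x.1 ∧ Kerr.radius a x.1 < ρ} ⊆
            belowZone 𝓢 M a Ψ ρ := by
  intro M a η R hM ha hη hR h3R
  obtain ⟨δ₀, hδ₀, H⟩ := farSilent_band_subset_docOf M a η R hM ha hη hR h3R
  refine ⟨δ₀, hδ₀, ?_⟩
  intro 𝓢 _ Ψ k δ' hk hδ' hFS ρ hρ
  rintro _ ⟨x, ⟨hxlo, hxρ⟩, rfl⟩
  exact ⟨⟨x, hxρ, rfl⟩, H 𝓢 Ψ k δ' hk hδ' hFS x hxlo (by linarith)⟩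

/-- **rev c11 — the d.o.c. localisation UNIFORMLY over a compact set of labels.** For a compact
`Kℓ ⊆ {0 < M, |a| < M}`, a width `η > 0` and a far radius `R(ℓ) ≥ max (r₊(ℓ) + η) (3 ℓ.1)`
continuous on `Kℓ` there is ONE `δ₀ > 0` such that at every label of `Kℓ` the conclusion of
`farSilent_band_subset_docOf` holds: from the label-uniform bricks
`Theorems.stub_docLocalisationU` (UD) and `Theorems.stub_kerrBilin_coercive_exteriorU` (UC) and a
positive lower bound of the masses over `Kℓ`. [folklore] -/
theorem farSilent_band_subset_docOfU :
    ∀ (Kℓ : Set (ℝ × ℝ)) (η : ℝ) (R : ℝ × ℝ → ℝ), IsCompact Kℓ →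
      (∀ ℓ ∈ Kℓ, 0 < ℓ.1 ∧ |ℓ.2| < ℓ.1) → 0 < η → ContinuousOn R Kℓ →
      (∀ ℓ ∈ Kℓ, Kerr.rPlus ℓ.1 ℓ.2 + η ≤ R ℓ) → (∀ ℓ ∈ Kℓ, 3 * ℓ.1 ≤ R ℓ) →
      ∃ δ₀ : ℝ, 0 < δ₀ ∧ ∀ ℓ ∈ Kℓ,
      ∀ (𝓢 : Spacetime.{0} 4) [𝓢.metric.HasLeviCivita]
        (Ψ : (starBG ℓ.1 ℓ.2).domain → 𝓢.carrier) (k : ℕ) (δ' : ℝ), 1 ≤ k → δ' ≤ δ₀ →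
        FarSilentNearKerr 𝓢 ℓ.1 ℓ.2 Ψ k δ' →
        ∀ x : (starBG ℓ.1 ℓ.2).domain, Kerr.rPlus ℓ.1 ℓ.2 + η ≤ Kerr.radius ℓ.2 x.1 →
          Kerr.radius ℓ.2 x.1 ≤ R ℓ → Ψ x ∈ docOf 𝓢 ℓ.1 ℓ.2 Ψ := by
  intro Kℓ η R hK hlab hη hRc hR h3R
  obtain ⟨δ, hδ, hlocU⟩ := Theorems.stub_docLocalisationU Kℓ η R hK hlab hη hRc hR
  obtain ⟨β, hβ, hcoerU⟩ := Theorems.stub_kerrBilin_coercive_exteriorU Kℓ (fun ℓ => ℓ.1) hK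
    (fun ℓ hℓ ↦ (hlab ℓ hℓ).1.le) continuous_fst.continuousOn (fun ℓ hℓ ↦ (hlab ℓ hℓ).1)
  -- a positive lower bound of the masses over the compact label set
  obtain ⟨m₁, hm₁, hm₁le⟩ := hK.exists_forall_le' continuous_fst.continuousOn
    (fun ℓ hℓ ↦ (hlab ℓ hℓ).1)
  refine ⟨min (β / 2) (δ * min 1 m₁), lt_min (by positivity) (by positivity), ?_⟩
  intro ℓ hℓ 𝓢 _ Ψ k δ' hk hδ' hFS x hxlo hxR
  have hδ'' : δ' ≤ min (β / 2) (δ * min 1 ℓ.1) :=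
    hδ'.trans (min_le_min le_rfl
      (mul_le_mul_of_nonneg_left (min_le_min le_rfl (hm₁le ℓ hℓ)) hδ.le))
  exact farSilent_band_subset_docOf_of (hlab ℓ hℓ).1 hη (h3R ℓ hℓ) hδ hβ (hcoerU ℓ hℓ)
    (hlocU ℓ hℓ) 𝓢 Ψ k δ' hk hδ'' hFS x hxlo hxR

/-- **rev c11 — `Ψ({r₊ + η ≤ r < ρ}) ⊆ belowZone ρ`, `ρ ≤ R(ℓ)`, UNIFORMLY over a compact set of
labels** (corollary of `farSilent_band_subset_docOfU`). [folklore corollary] -/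
theorem farSilent_band_subset_belowZoneU :
    ∀ (Kℓ : Set (ℝ × ℝ)) (η : ℝ) (R : ℝ × ℝ → ℝ), IsCompact Kℓ →
      (∀ ℓ ∈ Kℓ, 0 < ℓ.1 ∧ |ℓ.2| < ℓ.1) → 0 < η → ContinuousOn R Kℓ →
      (∀ ℓ ∈ Kℓ, Kerr.rPlus ℓ.1 ℓ.2 + η ≤ R ℓ) → (∀ ℓ ∈ Kℓ, 3 * ℓ.1 ≤ R ℓ) →
      ∃ δ₀ : ℝ, 0 < δ₀ ∧ ∀ ℓ ∈ Kℓ,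
      ∀ (𝓢 : Spacetime.{0} 4) [𝓢.metric.HasLeviCivita]
        (Ψ : (starBG ℓ.1 ℓ.2).domain → 𝓢.carrier) (k : ℕ) (δ' : ℝ), 1 ≤ k → δ' ≤ δ₀ →
        FarSilentNearKerr 𝓢 ℓ.1 ℓ.2 Ψ k δ' →
        ∀ ρ : ℝ, ρ ≤ R ℓ →
          Ψ '' {x | Kerr.rPlus ℓ.1 ℓ.2 + η ≤ Kerr.radius ℓ.2 x.1 ∧ Kerr.radius ℓ.2 x.1 < ρ} ⊆
            belowZone 𝓢 ℓ.1 ℓ.2 Ψ ρ := by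
  intro Kℓ η R hK hlab hη hRc hR h3R
  obtain ⟨δ₀, hδ₀, H⟩ := farSilent_band_subset_docOfU Kℓ η R hK hlab hη hRc hR h3R
  refine ⟨δ₀, hδ₀, ?_⟩
  intro ℓ hℓ 𝓢 _ Ψ k δ' hk hδ' hFS ρ hρ
  rintro _ ⟨x, ⟨hxlo, hxρ⟩, rfl⟩
  exact ⟨⟨x, hxρ, rfl⟩, H ℓ hℓ 𝓢 Ψ k δ' hk hδ' hFS x hxlo (by linarith)⟩



/-- **The chart package of an eternal star chart (rev c9's inline argument, packaged).** Under
`FarSilentNearKerr` at order `k` and tolerance `δ' ≤ δc(M, a)`, the star chart is a total map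
`Φ : E4 → 𝓢` agreeing with `Ψ` on the star domain `{r > M}`, smooth, openly embedded and injective
there, with injective differential (closeness to the uniformly coercive Kerr–Schild form,
`Theorems.stub_kerrBilin_coercive_exterior` + `Theorems.stub_injective_mfderiv_of_close`), and
with the pointwise bounds `‖Dʲ(Φ^*g − g_{M,a})(z)‖ ≤ δ' M / r^{j+1}`, `j ≤ k`. [folklore] -/
theorem farSilent_chartPackage_of {M a β : ℝ} (hM : 0 < M) (hβ : 0 < β)
    (hcoer : ∀ z : E4, M ≤ Kerr.radius a z → ∀ v : E4, β * ‖v‖ ≤ ‖Kerr.bilin M a z v‖) :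
    ∀ (𝓢 : Spacetime.{0} 4) [𝓢.metric.HasLeviCivita] (Ψ : (starBG M a).domain → 𝓢.carrier)
        (k : ℕ) (δ' : ℝ), 0 ≤ δ' → δ' ≤ β / 2 → FarSilentNearKerr 𝓢 M a Ψ k δ' →
        ∃ Φ : E4 → 𝓢.carrier,
          (∀ x : (starBG M a).domain, Φ x.1 = Ψ x) ∧
          {z : E4 | M < Kerr.radius a z} = ((starBG M a).domain : Set E4) ∧
          ContMDiffOn 𝓘(ℝ, E4) (𝓡 4) ∞ Φ {z | M < Kerr.radius a z} ∧
          Topology.IsOpenEmbedding ({z : E4 | M < Kerr.radius a z}.restrict Φ) ∧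
          InjOn Φ {z | M < Kerr.radius a z} ∧
          (∀ z : E4, M < Kerr.radius a z → Function.Injective (mfderiv 𝓘(ℝ, E4) (𝓡 4) Φ z)) ∧
          (∀ z : E4, M < Kerr.radius a z → ∀ j : ℕ, j ≤ k →
            ‖iteratedFDeriv ℝ j (fun z => 𝓢.metricInCoords Φ z - Kerr.bilin M a z) z‖ ≤
              δ' * M / Kerr.radius a z ^ (j + 1)) := by
  intro 𝓢 _ Ψ k δ' hδ'0 hδ' hFS
  obtain ⟨-, hΨs, hΨe, hbound⟩ := hFS
  obtain ⟨Φ, hΦΨ, hdom, hΦs, hΦe, -, hiter⟩ := Theorems.stub_starChartExtension 𝓢 M a Ψ hM hΨs hΨe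
  have hmem : ∀ z : E4, M < Kerr.radius a z → z ∈ ((starBG M a).domain : Set E4) := by
    intro z hz; rw [← hdom]; exact hz
  -- pointwise bounds of all orders `j ≤ k`
  have hpt : ∀ z : E4, M < Kerr.radius a z → ∀ j : ℕ, j ≤ k →
      ‖iteratedFDeriv ℝ j (fun z => 𝓢.metricInCoords Φ z - Kerr.bilin M a z) z‖ ≤
        δ' * M / Kerr.radius a z ^ (j + 1) := by
    intro z hz j hj
    have hr : 0 < Kerr.radius a z := hM.trans hz
    have hb := hbound ⟨z, hmem z hz⟩ j hj
    have hit := hiter j ⟨z, hmem z hz⟩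
    rw [le_div_iff₀ (by positivity), mul_comm, hit]
    exact hb
  -- injectivity of the differential from `C⁰`-closeness to the coercive Kerr–Schild form
  have hinj : ∀ z : E4, M < Kerr.radius a z → Function.Injective (mfderiv 𝓘(ℝ, E4) (𝓡 4) Φ z) := by
    intro z hz
    have hr : 0 < Kerr.radius a z := hM.trans hz
    refine Theorems.stub_injective_mfderiv_of_close.1 𝓢 Φ z (Kerr.bilin M a z) β hβ (hcoer z hz.le) ?_
    have h0 := hpt z hz 0 (Nat.zero_le _)
    rw [norm_iteratedFDeriv_zero, zero_add, pow_one] at h0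
    calc ‖𝓢.metricInCoords Φ z - Kerr.bilin M a z‖ ≤ δ' * M / Kerr.radius a z := h0
      _ ≤ δ' := by
          rw [div_le_iff₀ hr]
          exact mul_le_mul_of_nonneg_left hz.le hδ'0
      _ < β := by linarith
  refine ⟨Φ, hΦΨ, hdom, hΦs, hΦe, ?_, hinj, hpt⟩
  exact Set.injOn_iff_injective.2 hΦe.injective

/-- **The chart package of an eternal star chart, per label** (from the generic form
`farSilent_chartPackage_of` with the coercivity constant of
`Theorems.stub_kerrBilin_coercive_exterior`). [folklore] -/
theorem farSilent_chartPackage :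
    ∀ (M a : ℝ), 0 < M → |a| < M → ∃ δc : ℝ, 0 < δc ∧
      ∀ (𝓢 : Spacetime.{0} 4) [𝓢.metric.HasLeviCivita] (Ψ : (starBG M a).domain → 𝓢.carrier)
        (k : ℕ) (δ' : ℝ), 0 ≤ δ' → δ' ≤ δc → FarSilentNearKerr 𝓢 M a Ψ k δ' →
        ∃ Φ : E4 → 𝓢.carrier,
          (∀ x : (starBG M a).domain, Φ x.1 = Ψ x) ∧
          {z : E4 | M < Kerr.radius a z} = ((starBG M a).domain : Set E4) ∧
          ContMDiffOn 𝓘(ℝ, E4) (𝓡 4) ∞ Φ {z | M < Kerr.radius a z} ∧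
          Topology.IsOpenEmbedding ({z : E4 | M < Kerr.radius a z}.restrict Φ) ∧
          InjOn Φ {z | M < Kerr.radius a z} ∧
          (∀ z : E4, M < Kerr.radius a z → Function.Injective (mfderiv 𝓘(ℝ, E4) (𝓡 4) Φ z)) ∧
          (∀ z : E4, M < Kerr.radius a z → ∀ j : ℕ, j ≤ k →
            ‖iteratedFDeriv ℝ j (fun z => 𝓢.metricInCoords Φ z - Kerr.bilin M a z) z‖ ≤
              δ' * M / Kerr.radius a z ^ (j + 1)) := by
  intro M a hM ha
  obtain ⟨β, hβ, hcoer⟩ := Theorems.stub_kerrBilin_coercive_exterior M a M hM.le hM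
  exact ⟨β / 2, by positivity, farSilent_chartPackage_of hM hβ hcoer⟩

/-- **rev c11 — the chart package UNIFORMLY over a compact set of labels**: ONE `δc > 0` for all
labels of a compact `Kℓ ⊆ {0 < M, |a| < M}` (the coercivity constant is uniform,
`Theorems.stub_kerrBilin_coercive_exteriorU`). [folklore] -/
theorem farSilent_chartPackageU :
    ∀ (Kℓ : Set (ℝ × ℝ)), IsCompact Kℓ → (∀ ℓ ∈ Kℓ, 0 < ℓ.1 ∧ |ℓ.2| < ℓ.1) → ∃ δc : ℝ, 0 < δc ∧
      ∀ ℓ ∈ Kℓ, ∀ (𝓢 : Spacetime.{0} 4) [𝓢.metric.HasLeviCivita]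
        (Ψ : (starBG ℓ.1 ℓ.2).domain → 𝓢.carrier) (k : ℕ) (δ' : ℝ), 0 ≤ δ' → δ' ≤ δc →
        FarSilentNearKerr 𝓢 ℓ.1 ℓ.2 Ψ k δ' →
        ∃ Φ : E4 → 𝓢.carrier,
          (∀ x : (starBG ℓ.1 ℓ.2).domain, Φ x.1 = Ψ x) ∧
          {z : E4 | ℓ.1 < Kerr.radius ℓ.2 z} = ((starBG ℓ.1 ℓ.2).domain : Set E4) ∧
          ContMDiffOn 𝓘(ℝ, E4) (𝓡 4) ∞ Φ {z | ℓ.1 < Kerr.radius ℓ.2 z} ∧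
          Topology.IsOpenEmbedding ({z : E4 | ℓ.1 < Kerr.radius ℓ.2 z}.restrict Φ) ∧
          InjOn Φ {z | ℓ.1 < Kerr.radius ℓ.2 z} ∧
          (∀ z : E4, ℓ.1 < Kerr.radius ℓ.2 z → Function.Injective (mfderiv 𝓘(ℝ, E4) (𝓡 4) Φ z)) ∧
          (∀ z : E4, ℓ.1 < Kerr.radius ℓ.2 z → ∀ j : ℕ, j ≤ k →
            ‖iteratedFDeriv ℝ j (fun z => 𝓢.metricInCoords Φ z - Kerr.bilin ℓ.1 ℓ.2 z) z‖ ≤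
              δ' * ℓ.1 / Kerr.radius ℓ.2 z ^ (j + 1)) := by
  intro Kℓ hK hlab
  obtain ⟨β, hβ, hcoerU⟩ := Theorems.stub_kerrBilin_coercive_exteriorU Kℓ (fun ℓ => ℓ.1) hK
    (fun ℓ hℓ ↦ (hlab ℓ hℓ).1.le) continuous_fst.continuousOn (fun ℓ hℓ ↦ (hlab ℓ hℓ).1)
  exact ⟨β / 2, by positivity, fun ℓ hℓ ↦ farSilent_chartPackage_of (hlab ℓ hℓ).1 hβ (hcoerU ℓ hℓ)⟩


/-- `r₊(M, a) < r_ph⁻(M, a) = photonOrbitRadius M |a|`. [cite: Sbierski2015, §7A] -/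
theorem rPlus_lt_rPhMinus {M a : ℝ} (hM : 0 < M) : Kerr.rPlus M a < rPhMinus M a := by
  have h : Kerr.rPlus M a = Kerr.rPlus M |a| := by
    unfold Kerr.rPlus; rw [sq_abs]
  rw [h]
  exact Kerr.rPlus_lt_photonOrbitRadius hM (abs_nonneg a)


end Summit.FinalStateConjecture.FinalStateConjecture.Theorems.PhotonShellNode

end
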